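import Literature.NumberTheory.Automorphic.Liu2021.LemD1SplitPlaceOfFacts
import HarnessLib

/-!
# FLOOR-0 P3b «ENGINE local packets», line `F0_LocalAPackets` — HELPER E2-T4b″: the split-place member
# `i_G(ξ_w) = (ν₀ ∘ det_{GL_{N−1}}) × χ′` is ADMISSIBLE (discharges the `hadm` binder of the line's `cmSplitPacket_traceSum`)

Cell hodgecm-mathlib (D-0151), FLOOR 0, crux item H413 = stmt-HodgeConjecture-24833; sub-line
`Cruxes/H413/Lines/F0_LocalAPackets.lean` (F0P3b-plan (g5), edition 2 ∕ 3), §5 «split finite places».  HELPER BY NAME, no stub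
(F0P3b-plan (g5) ruling 01:43:35Z «E2-T4b″ YES, as a HELPER BY NAME»); PROOF lane (theorems only); author B-p08 (g17).

Content.  For a non-archimedean local field `F`, every `N` and CONTINUOUS characters `ν₀, χ′ : Fˣ → ℂˣ`, the normalised
parabolic induction `i_{GL_N, Q_{(N−1,1)}}((ν₀ ∘ det) ⊠ χ′)` — the tree's ★
`Representation.parabolicIndGL F (lastBlockLabel N) (𝟙.twist (maxParabolicLeviChar F N ν₀ χ′))`, i.e. the `ρ` of the line's
`splitMemberGL` at `N = 3` — is ADMISSIBLE: the inducing one-dimensional character has open kernel (a continuous character of the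
totally disconnected group `Fˣ` into `ℂˣ` is locally constant — no small subgroups: ★ `Liu2021.SplitPlace.isOpen_ker_of_continuous`,
★ `isOpen_ker_maxParabolicLeviChar`), so it is admissible (★ `Liu2021.SplitPlace.isAdmissible_trivial_twist`), and parabolic
induction from the cocompact `Q_{(N−1,1)}` preserves admissibility (★ `Representation.isAdmissible_parabolicIndGL_holds`
[BernsteinZelevinskyASENS1977, Prop. 2.3]).  Unitarity of `ν₀, χ′` is NOT needed here (it is needed for irreducibility, ★ Zelevinsky).
With it, ed. 3.x of the line states `cmSplitPacket_traceSum` without the `hadm` binder.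

HC_CM is proved only modulo the 7 printed citations until rung 0 closes; this is ONE helper of ONE floor-0 sub-line.

## References
* [BernsteinZelevinskyASENS1977] I. N. Bernstein, A. V. Zelevinsky, *Induced representations of reductive p-adic groups I*,
  Ann. Sci. ÉNS 10 (1977) — Prop. 2.3 (induction preserves admissibility).
* [Rogawski1990] J. Rogawski, *Automorphic Representations of Unitary Groups in Three Variables*, Ann. of Math. Stud. 123 (1990)
  — §13.3 p. 201 (split places), §12.2 p. 174.
-/

set_option autoImplicit false
set_option linter.dupNamespace false

noncomputable section

namespace Summit.HodgeConjecture.HodgeConjecture.Cruxes.H413.F0P3bSplitMemberAdmissible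

open Literature.NumberTheory.Automorphic Literature.NumberTheory.Automorphic.Zelevinsky1980

variable (F : Type*) [Field F] [ValuativeRel F] [TopologicalSpace F] [IsNonarchimedeanLocalField F]

/-- **The inducing character `(ν₀ ∘ det) ⊠ χ′` of the Levi `GL_{N−1} × GL_1` is admissible** for continuous `ν₀, χ′`
(open kernel ⇒ smooth; one-dimensional ⇒ finite fixed vectors). [cite: BernsteinZelevinskyASENS1977, Prop. 2.3] -/
theorem leviChar_isAdmissible (N : ℕ) (ν₀ χ' : Fˣ →* ℂˣ) (hν₀c : Continuous fun x => ((ν₀ x : ℂˣ) : ℂ))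
    (hχ'c : Continuous fun x => ((χ' x : ℂˣ) : ℂ)) :
    ((Representation.trivial ℂ (Π a : Bool, GL {i : Fin N // lastBlockLabel N i = a} F) ℂ).twist
      (maxParabolicLeviChar F N ν₀ χ')).IsAdmissible :=
  Liu2021.SplitPlace.isAdmissible_trivial_twist _
    (Liu2021.SplitPlace.isOpen_ker_maxParabolicLeviChar N ν₀ χ' (Liu2021.SplitPlace.isOpen_ker_of_continuous ν₀ hν₀c)
      (Liu2021.SplitPlace.isOpen_ker_of_continuous χ' hχ'c))

/-- **`i_{GL_N}((ν₀ ∘ det) ⊠ χ′)` is ADMISSIBLE** for continuous `ν₀, χ′` and every `N` (★ `isAdmissible_parabolicIndGL_holds` on the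
admissible one-dimensional inducing datum).  At `N = 3` this is `(splitMemberGL F ν₀ χ′ …).ρ.IsAdmissible` of the line (by `rfl` on
the `ρ` field), discharging the `hadm` binder of `cmSplitPacket_traceSum`. [cite: BernsteinZelevinskyASENS1977, Prop. 2.3] -/
theorem parabolicIndGL_leviChar_isAdmissible (N : ℕ) [LocallyCompactSpace (standardParabolicGL F (lastBlockLabel N))]
    (ν₀ χ' : Fˣ →* ℂˣ) (hν₀c : Continuous fun x => ((ν₀ x : ℂˣ) : ℂ)) (hχ'c : Continuous fun x => ((χ' x : ℂˣ) : ℂ)) :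
    (Representation.parabolicIndGL F (lastBlockLabel N)
      ((Representation.trivial ℂ (Π a : Bool, GL {i : Fin N // lastBlockLabel N i = a} F) ℂ).twist
        (maxParabolicLeviChar F N ν₀ χ'))).IsAdmissible :=
  Representation.isAdmissible_parabolicIndGL_holds F (lastBlockLabel N) _ (leviChar_isAdmissible F N ν₀ χ' hν₀c hχ'c)

end Summit.HodgeConjecture.HodgeConjecture.Cruxes.H413.F0P3bSplitMemberAdmissible
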